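import Summits.ResolutionOfSingularities.ResolutionOfSingularities.Theorems.EquisingularLiftEquisingularLiftNatF102FibreTransport
import Summits.ResolutionOfSingularities.ResolutionOfSingularities.Theorems.EquisingularLiftEquisingularLiftNatF102TwoSections
import Summits.ResolutionOfSingularities.ResolutionOfSingularities.Theorems.EquisingularLiftEquisingularLiftNatF102IsoOfIdealModules
import Summits.ResolutionOfSingularities.ResolutionOfSingularities.Theorems.EquisingularLiftEquisingularLiftNatF102IdealLineBundle
import Summits.ResolutionOfSingularities.ResolutionOfSingularities.Theorems.EquisingularLiftEquisingularLiftNatF102SectionLineBundle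
import Summits.ResolutionOfSingularities.ResolutionOfSingularities.Theorems.EquisingularLiftEquisingularLiftNatF102FramePrescribed
import Summits.ResolutionOfSingularities.ResolutionOfSingularities.Theorems.EquisingularLiftEquisingularLiftNatF102IsoOfCharts
import Summits.ResolutionOfSingularities.ResolutionOfSingularities.Theorems.EquisingularLiftEquisingularLiftNatF102PointIdeal
import Literature.AlgebraicGeometry.Modules.KernelFiniteLocallyFree
import Literature.AlgebraicGeometry.Modules.PullbackFrame
import Literature.AlgebraicGeometry.Modules.IsoOfFrames
import Mathlib.RingTheory.LocalProperties.Basic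
import HarnessLib

/-!
# [OURS · L1 W4.5(b) · LINE (T-j)-PROOF · BRICK B4 (γ*), brick (α)] The restriction of the ideal `𝓘_D` of a section to the
# closed fibre `C_k ≅ ℙ¹` is the ideal of the point `D ∩ C_k`

Cell res-hironaka, LADDER-RESOLUTION rung L, slot W4.5(b), crux chain w45b: EL♮(3) = stmt-ResolutionOfSingularities-20148, residue
(T-j) = F-102 `Literature.AlgebraicGeometry.Resolution.GenusZeroOverCompleteDVR` (LINE (T-j)-PROOF, res-L1-w45b-lead-2 g3, skeleton v3
1683bb741349c142), BRICK B4 sub-brick (γ*) `F102.nonempty_pullback_sheafHom_idealModule_iso_unit` (skeleton `GammaStarSkeleton`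
7d8d5eef49743d69), brick **(α)** (lead-2's own piece; bricks (β) res-D-pv-036 p581953, (γ) res-rescue-typ-5 p581858, PointIdeal
res-L1-type-o6). `--supports stmt-ResolutionOfSingularities-20148 --as helper`. NOT a statement of any manuscript; OURS; AI-written,
weaker than expert review. No `sorry`; standard axioms; DEF-FREE.

THEOREM (`nonempty_pullback_idealModule_section_iso`). `O` a DVR, `θ : O ↠ k`, `f : C → Spec O` proper flat with `C` regular and
integral, `(i, t)` cartesian over `Spec θ`, `e : C_k ≅ ℙ¹_{k'}`, `s` a section of `f` through `z_j = i(e⁻¹ y_j)`. Then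
`i^*𝓘_D ≅ 𝓘_{z_j}` — the inverse image on the closed fibre of the ideal module of `D = s(Spec O)` is the ideal module of the
`k'`-point `pt_j ≫ e⁻¹ : Spec k' → C_k`.

PROOF (frames with prescribed generators; no Tor, no tensor identities). Cover `C` by affine opens `V_x` with `(ker s)(V_x) = (r_x)`
(res-L1-type-o6 `exists_affine_principal`). Upstairs, frame `𝓘_D|_{V_x}` by the section reading to `r_x` ((a1)
`nonempty_basis_sections_idealModule_of_span_singleton` + `exists_frame_basisSection_eq`, p581631) and pull the frame back to
`i⁻¹V_x` (`pullbackFrame`). Downstairs, `(ker p)(i⁻¹V_x) = (i♯ r_x)` for any `k'`-point `p` at `z_j`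
(`ker_ideal_point_eq_span_app`: at `z_j` the germ of `i♯r_x` generates `𝔪_{C_k,z_j}` by res-D-pv-035's
`map_stalkMap_stalkIdeal_ker_section` — `𝔪 = (ker s) + (ϖ)` and the fibre kills `ϖ` —, off `z_j` it is a unit
(`mem_basicOpen_app_of_ne`: the only point of `C_k` on `D` is `z_j`, `i_inv_mem_range_section_iff`, and off `Supp(ker s) = D` some
element of `(r_x)` is invertible), and PointIdeal (P1)/(P3)/(P4) turn this into the ideal statement), so `𝓘_{z_j}|_{i⁻¹V_x}` is
framed by the section reading to `i♯ r_x` (`i♯ r_x` is a non-zero-divisor: the generic point of `C_k` lies in `D(i♯ r_x)`). Both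
transition functions on `i⁻¹V_x ∩ i⁻¹V_y` equal `i♯ T(φ_x, φ_y)` (`transition_pullbackFrame`; `𝓘 ↪ 𝒪` injective on sections),
and `isoOfFrames` glues.
-/

noncomputable section

-- `TopCat.Presheaf`/`Scheme.Modules` are not reducible (as in Mathlib's `AlgebraicGeometry/Modules`).
set_option backward.isDefEq.respectTransparency false

open CategoryTheory CategoryTheory.Limits AlgebraicGeometry TopologicalSpace Opposite IsLocalRing
open Literature.AlgebraicGeometry Literature.AlgebraicGeometry.Morphisms Literature.AlgebraicGeometry.Modules
open Literature.AlgebraicGeometry.Motives Literature.AlgebraicGeometry.Deformation Literature.AlgebraicGeometry.HodgeTheory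
open Literature.AlgebraicGeometry.Resolution

set_option linter.dupNamespace false -- mandated namespace `Summit.<Summit>.<Problem>` of this single-conjunct summit

namespace Summit.ResolutionOfSingularities.ResolutionOfSingularities.Cruxes.EquisingularLiftNat.F102


/-! ## The ideal of the point `z_j = D ∩ C_k` on the affine pieces `i⁻¹V` -/

/-- Off the point `z_j = e⁻¹(y_j)`, a generator `r` of `𝓘_D` on an affine `V` becomes a unit on `i⁻¹V`: `q ∈ i⁻¹V`, `q ≠ z_j` ⇒
`q ∈ D(i♯ r)` (the only point of `C_k` on `D` is `z_j`, and off `D = Supp(ker s)` some element of `(ker s)(V) = (r)` is invertible).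
[OURS] -/
theorem mem_basicOpen_app_of_ne {O : Type} [CommRing O] [IsLocalRing O] {k : Type} [Field k] (θ : O →+* k)
    (hθ : Function.Surjective θ) {C Ck : Scheme.{0}} (f : C ⟶ Spec (.of O)) (i : Ck ⟶ C) (t : Ck ⟶ Spec (.of k))
    (hsq : IsPullback i t f (Spec.map (CommRingCat.ofHom θ))) {k' : Type} [Field k'] (e : Ck ≅ ProjCech.PP k' 1)
    (s : Spec (.of O) ⟶ C) (hs : s ≫ f = 𝟙 _) [IsClosedImmersion s] (j : Fin 2)
    (hz : s.base (closedPoint O) = i.base (e.inv.base (ProjLine.y k' j)))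
    (V : C.affineOpens) (r : Γ(C, (V : C.Opens))) (hI : s.ker.ideal V = Ideal.span {r})
    (q : Ck) (hq : q ∈ i ⁻¹ᵁ (V : C.Opens)) (hne : q ≠ e.inv.base (ProjLine.y k' j)) :
    q ∈ Ck.basicOpen (i.app (V : C.Opens) r) := by
  have hqq : e.inv.base (e.hom.base q) = q := (Scheme.homeoOfIso e).symm_apply_apply q
  -- `i q ∉ range s`
  have hnot : i.base q ∉ Set.range s.base := by
    intro hmem
    have h := (i_inv_mem_range_section_iff θ hθ f i t hsq e s hs j hz (e.hom.base q)).mp (by rw [hqq]; exact hmem)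
    exact hne (by rw [← hqq, h])
  -- hence `i q ∉ Supp (ker s)`, so some element of `(ker s)(V) = (r)` is a unit at `i q`
  have hsupp : i.base q ∉ s.ker.support := by
    intro h
    have h' : i.base q ∈ (s.ker.support : Set C) := h
    rw [Scheme.Hom.support_ker, s.isClosedEmbedding.isClosed_range.closure_eq] at h'
    exact hnot h'
  rw [Scheme.IdealSheafData.mem_support_iff_of_mem (U := V) hq, Scheme.mem_zeroLocus_iff] at hsupp
  push Not at hsupp
  obtain ⟨g, hg, hgq⟩ := hsupp
  rw [hI] at hg
  obtain ⟨a, rfl⟩ := Ideal.mem_span_singleton'.mp hg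
  rw [Scheme.basicOpen_mul] at hgq
  rw [← Scheme.preimage_basicOpen]
  exact hgq.2


/-- **The ideal of the point `z = D ∩ C_k` on an affine piece `i⁻¹V`** (for ANY `k'`-point `p : Spec k' → C_k` located at
`z = e⁻¹(y_j)`): if `(ker s)(V) = (r)` then `(ker p)(i⁻¹V) = (i♯ r)`. At `z` the germ of `i♯r` generates `𝔪_{C_k,z}`
(res-D-pv-035's `map_stalkMap_stalkIdeal_ker_section`: `𝔪_z = (ker s)_z + (ϖ)` and the fibre kills `ϖ`); elsewhere on `i⁻¹V`
it is a unit (`mem_basicOpen_app_of_ne`); PointIdeal (P1)/(P3)/(P4) convert this into the ideal statement. [OURS] -/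
theorem ker_ideal_point_eq_span_app (O : Type) [CommRing O] [IsDomain O] [IsDiscreteValuationRing O] (k : Type) [Field k]
    (θ : O →+* k) (hθ : Function.Surjective θ) {C Ck : Scheme.{0}} (f : C ⟶ Spec (.of O)) (i : Ck ⟶ C)
    (t : Ck ⟶ Spec (.of k)) (hsq : IsPullback i t f (Spec.map (CommRingCat.ofHom θ))) {k' : Type} [Field k']
    (e : Ck ≅ ProjCech.PP k' 1) (s : Spec (.of O) ⟶ C) (hs : s ≫ f = 𝟙 _) [IsClosedImmersion s] (j : Fin 2)
    (hz : s.base (closedPoint O) = i.base (e.inv.base (ProjLine.y k' j)))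
    (p : Spec (.of k') ⟶ Ck) [QuasiCompact p] (hp : p.base (closedPoint k') = e.inv.base (ProjLine.y k' j))
    (V : C.affineOpens) (r : Γ(C, (V : C.Opens))) (hI : s.ker.ideal V = Ideal.span {r})
    (hU : IsAffineOpen (i ⁻¹ᵁ (V : C.Opens))) :
    p.ker.ideal ⟨i ⁻¹ᵁ (V : C.Opens), hU⟩ = Ideal.span {i.app (V : C.Opens) r} := by
  have hunit : ∀ q ∈ i ⁻¹ᵁ (V : C.Opens), q ≠ p.base (closedPoint k') → q ∈ Ck.basicOpen (i.app (V : C.Opens) r) :=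
    fun q hq hne => mem_basicOpen_app_of_ne θ hθ f i t hsq e s hs j hz V r hI q hq (hp ▸ hne)
  by_cases hy : p.base (closedPoint k') ∈ i ⁻¹ᵁ (V : C.Opens)
  · -- the point lies in `i⁻¹V`: `ker p = 𝔭_z = (i♯ r)`
    have hzc : IsClosed ({p.base (closedPoint k')} : Set Ck) := by
      rw [hp, ← Set.image_singleton]
      exact e.inv.isClosedEmbedding.isClosedMap _ (isClosed_singleton_y k' j)
    have hx : s.base (closedPoint O) = i.base (p.base (closedPoint k')) := by rw [hp]; exact hz
    have hg : Ideal.span {Ck.presheaf.germ (i ⁻¹ᵁ (V : C.Opens)) (p.base (closedPoint k')) hy (i.app (V : C.Opens) r)} =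
        maximalIdeal (Ck.presheaf.stalk (p.base (closedPoint k'))) := by
      have h1 := map_stalkMap_stalkIdeal_ker_section O k θ hθ f i t hsq s hs (p.base (closedPoint k')) hx
      rw [stalkIdeal_eq_map_germ s.ker V hy, hI, Ideal.map_span, Set.image_singleton, Ideal.map_span,
        Set.image_singleton] at h1
      rw [← h1]
      congr 2
      exact (Scheme.Hom.germ_stalkMap_apply i (V : C.Opens) (p.base (closedPoint k')) hy r).symm
    rw [ker_ideal_eq_primeIdealOf p ⟨i ⁻¹ᵁ (V : C.Opens), hU⟩ hy]
    exact primeIdealOf_eq_span ⟨i ⁻¹ᵁ (V : C.Opens), hU⟩ hy hzc _ hg hunit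
  · -- the point is not in `i⁻¹V`: both sides are `⊤`
    rw [ker_ideal_eq_top_of_not_mem p ⟨i ⁻¹ᵁ (V : C.Opens), hU⟩ hy, eq_comm, Ideal.span_singleton_eq_top]
    refine RingedSpace.isUnit_of_isUnit_germ (X := Ck.toLocallyRingedSpace.toRingedSpace) (i ⁻¹ᵁ (V : C.Opens)) _
      fun q hq => ?_
    have hne : q ≠ p.base (closedPoint k') := fun h => hy (h ▸ hq)
    exact (Scheme.mem_basicOpen (X := Ck) _ q hq).mp (hunit q hq hne)

/-! ## Small tools -/

/-- `i♯` on a restricted section, read on a smaller open of `C_k`: `i.appLE V' W (r|_{V'}) = (i.app V r)|_W`. [folklore] -/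
theorem appLE_map_eq_map_app {C Ck : Scheme.{0}} (i : Ck ⟶ C) {V V' : C.Opens} (h : V' ≤ V) {W : Ck.Opens}
    (l : W ≤ i ⁻¹ᵁ V') (k : W ⟶ i ⁻¹ᵁ V) (r : Γ(C, V)) :
    i.appLE V' W l (C.presheaf.map (homOfLE h).op r) = Ck.presheaf.map k.op (i.app V r) := by
  have h1 : i.appLE V' W l (C.presheaf.map (homOfLE h).op r) = (C.presheaf.map (homOfLE h).op ≫ i.appLE V' W l) r := rfl
  have h2 : Ck.presheaf.map k.op (i.app V r) = (i.app V ≫ Ck.presheaf.map k.op) r := rfl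
  rw [h1, h2, Scheme.Hom.map_appLE, Scheme.Hom.app_eq_appLE, Scheme.Hom.appLE_map]

/-- In rank one, the single transition coefficient is read off from `b'| = c • b|`. [folklore] -/
theorem transition_fin_one_eq_of_eq_smul {X : Scheme.{0}} {E : X.Modules} {W W' V : X.Opens}
    (e : SheafOfModules.free (Fin 1) ≅ E.over W) (e' : SheafOfModules.free (Fin 1) ≅ E.over W')
    (k : V ⟶ W) (k' : V ⟶ W') (c : Γ(X, V))
    (h : E.presheaf.map k'.op (basisSection e' 0) = c • E.presheaf.map k.op (basisSection e 0)) :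
    transition e e' k k' = Matrix.of fun _ _ => c := by
  classical
  ext m n
  obtain rfl : m = 0 := Subsingleton.elim _ _
  obtain rfl : n = 0 := Subsingleton.elim _ _
  rw [transition_apply, h, coord_smul, coord_map_basisSection, if_pos rfl, mul_one, Matrix.of_apply]

/-- The transition relation of rank-one frames: `b'| = T₀₀ • b|`. [folklore] -/
theorem map_basisSection_eq_transition_smul {X : Scheme.{0}} {E : X.Modules} {W W' V : X.Opens}
    (e : SheafOfModules.free (Fin 1) ≅ E.over W) (e' : SheafOfModules.free (Fin 1) ≅ E.over W')
    (k : V ⟶ W) (k' : V ⟶ W') :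
    E.presheaf.map k'.op (basisSection e' 0) = transition e e' k k' 0 0 • E.presheaf.map k.op (basisSection e 0) := by
  rw [map_basisSection_eq_sum_transition e e' k k' 0, Fin.sum_univ_one]

/-! ## Brick (α) -/

/-- **BRICK (α) of (γ*) — the ideal of a section restricted to the closed fibre.** F-102 setting: `O` a DVR, `θ : O ↠ k`,
`f : C → Spec O` proper flat with `C` regular integral, `(i, t)` cartesian over `Spec θ`, `e : C_k ≅ ℙ¹_{k'}`, `s` a section of
`f` through `z_j = i(e⁻¹ y_j)`. Then `i^* 𝓘_D ≅ 𝓘_{z_j}`, the ideal module of the `k'`-point `pt_j ≫ e⁻¹ : Spec k' → C_k`.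
PROOF (frames, no Tor): cover `C` by affine opens `V_x` on which `(ker s) = (r_x)` (res-L1-type-o6 `exists_affine_principal`); frame
`𝓘_D|_{V_x}` by the section reading to `r_x` ((a1) + `exists_frame_basisSection_eq`) and pull back (`pullbackFrame`); frame
`𝓘_{z_j}|_{i⁻¹V_x}` by the section reading to `i♯ r_x` (`ker_ideal_point_eq_span_app`); both transition functions on
`i⁻¹V_x ∩ i⁻¹V_y` are `i♯(r_y/r_x)` (`transition_pullbackFrame`; injectivity of `𝓘 ↪ 𝒪` on sections); glue with `isoOfFrames`. [OURS] -/
theorem nonempty_pullback_idealModule_section_iso (O : Type) [CommRing O] [IsDomain O]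
    [IsDiscreteValuationRing O] (k : Type) [Field k] (θ : O →+* k)
    (C : Scheme.{0}) (f : C ⟶ Spec (.of O)) [IsProper f] [Flat f]
    (Ck : Scheme.{0}) (i : Ck ⟶ C) (t : Ck ⟶ Spec (.of k)) [IsIntegral C]
    (hθ : Function.Surjective θ) (hreg : Resolution.Scheme.IsRegular C)
    (hsq : IsPullback i t f (Spec.map (CommRingCat.ofHom θ)))
    (k' : Type) [Field k'] (e : Ck ≅ ProjCech.PP k' 1)
    (s : Spec (.of O) ⟶ C) (hs : s ≫ f = 𝟙 _) (j : Fin 2)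
    (hz : s.base (closedPoint O) = i.base (e.inv.base (ProjLine.y k' j))) :
    Nonempty ((Scheme.Modules.pullback i).obj (idealModule s) ≅ idealModule (ProjLine.ptHom k' j ≫ e.inv)) := by
  classical
  -- instances
  have hP1 : ∃ (k' : Type) (_ : Field k'), Nonempty (Ck ≅ ProjCech.PP k' 1) := ⟨k', inferInstance, ⟨e⟩⟩
  have hri := isRegularImmersionOfCodim_one_of_section O k θ C f Ck i t hθ hreg hsq hP1 s hs
  haveI : IsClosedImmersion s := hri.1
  haveI : IsLocallyNoetherian C := LocallyOfFiniteType.isLocallyNoetherian f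
  haveI : IsClosedImmersion i := P1VB.isClosedImmersion_of_isPullback θ f hθ hsq
  haveI : IsProper (Segre.toSpec (Fin 2) k') := ProjLine.isProper_toSpec k'
  haveI : IsLocallyNoetherian (ProjCech.PP k' 1) := LocallyOfFiniteType.isLocallyNoetherian (ProjCech.toSpec k' 1)
  haveI : IsLocallyNoetherian Ck := isLocallyNoetherian_of_isOpenImmersion e.hom
  haveI : IsIntegral (ProjCech.PP k' 1) := isIntegral_PP k'
  haveI : IsIntegral Ck := IsIntegral.of_isIso e.inv
  haveI : IsClosedImmersion (ProjLine.ptHom k' j ≫ Segre.toSpec (Fin 2) k') := by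
    rw [ProjLine.ptHom_toSpec]
    exact IsClosedImmersion.spec_of_surjective _ (fun a => ⟨a, rfl⟩)
  haveI : IsClosedImmersion (ProjLine.ptHom k' j) :=
    IsClosedImmersion.of_comp (ProjLine.ptHom k' j) (Segre.toSpec (Fin 2) k')
  set p : Spec (.of k') ⟶ Ck := ProjLine.ptHom k' j ≫ e.inv with hpdef
  haveI : IsClosedImmersion p := inferInstance
  have hp : p.base (closedPoint k') = e.inv.base (ProjLine.y k' j) := by
    rw [hpdef]; rfl
  set I : C.Modules := idealModule s with hIdef
  set J : Ck.Modules := idealModule p with hJdef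
  -- the affine cover of `C` by principal opens of `ker s`
  choose V hxV r hr0 hI using exists_affine_principal s hri
  -- upstairs frames with basis section reading to `r x`
  have hVne : ∀ x : C, Nonempty ((V x : C.Opens)) := fun x => ⟨⟨x, hxV x⟩⟩
  have hrreg : ∀ (x : C) (a : Γ(C, (V x : C.Opens))), a * r x = 0 → a = 0 := fun x a ha => by
    haveI := hVne x
    exact (mul_eq_zero.mp ha).resolve_right (hr0 x)
  choose b hb using fun x => nonempty_basis_sections_idealModule_of_span_singleton s (V x) (r x) (hrreg x) (hI x).symm
  choose φ hφ using fun x => exists_frame_basisSection_eq I (coh_idealModule s).loc (V x) (b x)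
  -- downstairs: the affine pieces `U x = i⁻¹ V x`, the generators `ρ x = i♯ (r x)`
  have hUaff : ∀ x : C, IsAffineOpen (i ⁻¹ᵁ (V x : C.Opens)) := fun x => (V x).2.preimage i
  let U : C → Ck.affineOpens := fun x => ⟨i ⁻¹ᵁ (V x : C.Opens), hUaff x⟩
  let ρ : ∀ x : C, Γ(Ck, (U x : Ck.Opens)) := fun x => i.app (V x : C.Opens) (r x)
  have hJ : ∀ x : C, p.ker.ideal (U x) = Ideal.span {ρ x} := fun x =>
    ker_ideal_point_eq_span_app O k θ hθ f i t hsq e s hs j hz p hp (V x) (r x) (hI x) (hUaff x)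
  -- `ρ x` is a non-zero-divisor on `Γ(U x)`
  have hρreg : ∀ (x : C) (a : Γ(Ck, (U x : Ck.Opens))), a * ρ x = 0 → a = 0 := by
    intro x a ha
    by_cases hne : Nonempty ((U x : Ck.Opens))
    · haveI := hne
      refine (mul_eq_zero.mp ha).resolve_right fun h0 => ?_
      -- the generic point of `C_k` lies in `U x`, is not the closed point `z_j`, hence in `D(ρ x) = D(0) = ∅`
      have hξU : genericPoint Ck ∈ (U x : Ck.Opens) := by
        obtain ⟨⟨q, hq⟩⟩ := hne
        exact ((genericPoint_spec Ck).mem_open_set_iff (U x).1.2).mpr ⟨q, Set.mem_univ _, hq⟩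
      have hξne : genericPoint Ck ≠ p.base (closedPoint k') := by
        intro hξ
        have hcl : closure ({p.base (closedPoint k')} : Set Ck) = Set.univ := by
          rw [← hξ]; exact (genericPoint_spec Ck).def
        have hzc : IsClosed ({p.base (closedPoint k')} : Set Ck) := by
          rw [hp, ← Set.image_singleton]
          exact e.inv.isClosedEmbedding.isClosedMap _ (isClosed_singleton_y k' j)
        rw [hzc.closure_eq] at hcl
        have h2 : e.inv.base (ProjLine.y k' (ProjLine.other j)) ∈ ({p.base (closedPoint k')} : Set Ck) := by
          rw [hcl]; trivial
        rw [Set.mem_singleton_iff, hp] at h2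
        have h3 := e.inv.isClosedEmbedding.injective h2
        fin_cases j
        · exact ProjLine.y_zero_ne_y_one k' h3.symm
        · exact ProjLine.y_zero_ne_y_one k' h3
      have hξD := mem_basicOpen_app_of_ne θ hθ f i t hsq e s hs j hz (V x) (r x) (hI x) (genericPoint Ck) hξU
        (hp ▸ hξne)
      change genericPoint Ck ∈ Ck.basicOpen (ρ x) at hξD
      rw [h0, Scheme.basicOpen_zero] at hξD
      exact hξD
    · rw [not_nonempty_iff] at hne
      have hbot : (U x : Ck.Opens) = ⊥ := Opens.coe_eq_empty.mp (Set.isEmpty_coe_sort.mp hne)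
      haveI : Subsingleton Γ(Ck, (U x : Ck.Opens)) :=
        CommRingCat.subsingleton_of_isTerminal (Ck.sheaf.isTerminalOfEqEmpty hbot)
      exact Subsingleton.elim _ _
  -- downstairs frames with basis section reading to `ρ x`
  choose c hc using fun x => nonempty_basis_sections_idealModule_of_span_singleton p (U x) (ρ x) (hρreg x) (hJ x).symm
  choose ψ hψ using fun x => exists_frame_basisSection_eq J (coh_idealModule p).loc (U x) (c x)
  -- the pulled-back frames of `i^*𝓘_D` on the same opens
  let χ : ∀ x : C, SheafOfModules.free (Fin 1) ≅ ((Scheme.Modules.pullback i).obj I).over (U x : Ck.Opens) :=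
    fun x => pullbackFrame i (φ x)
  -- the cover
  have hcov : ⨆ x, (U x : Ck.Opens) = ⊤ :=
    top_le_iff.mp fun q _ => Opens.mem_iSup.mpr ⟨i.base q, hxV (i.base q)⟩
  -- equal transition functions
  have hT : ∀ x y : C,
      transition (χ x) (χ y) (Opens.infLELeft (U x : Ck.Opens) (U y)) (Opens.infLERight (U x : Ck.Opens) (U y)) =
      transition (ψ x) (ψ y) (Opens.infLELeft (U x : Ck.Opens) (U y)) (Opens.infLERight (U x : Ck.Opens) (U y)) := by
    intro x y
    -- notation
    have l : (U x : Ck.Opens) ⊓ (U y : Ck.Opens) ≤ i ⁻¹ᵁ ((V x : C.Opens) ⊓ (V y : C.Opens)) := fun q hq => hq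
    set g := i.appLE ((V x : C.Opens) ⊓ (V y : C.Opens)) ((U x : Ck.Opens) ⊓ (U y : Ck.Opens)) l with hgdef
    set cT := transition (φ x) (φ y) (homOfLE (inf_le_left : (V x : C.Opens) ⊓ (V y : C.Opens) ≤ _))
      (homOfLE (inf_le_right : (V x : C.Opens) ⊓ (V y : C.Opens) ≤ _)) 0 0 with hcTdef
    -- upstairs: `r y| = cT · r x|`
    have hup : C.presheaf.map (homOfLE (inf_le_right : (V x : C.Opens) ⊓ (V y : C.Opens) ≤ _)).op (r y) =
        cT * C.presheaf.map (homOfLE (inf_le_left : (V x : C.Opens) ⊓ (V y : C.Opens) ≤ _)).op (r x) := by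
      have h := map_basisSection_eq_transition_smul (φ x) (φ y)
        (homOfLE (inf_le_left : (V x : C.Opens) ⊓ (V y : C.Opens) ≤ _))
        (homOfLE (inf_le_right : (V x : C.Opens) ⊓ (V y : C.Opens) ≤ _))
      rw [hφ x, hφ y] at h
      have h' := congrArg (toRing (idealModuleι s) _) h
      rw [toRing_smul, ← map_toRing, ← map_toRing, hb x, hb y] at h'
      exact h'
    -- downstairs, applying `i♯`: `ρ y| = g(cT) · ρ x|`
    have hdown : Ck.presheaf.map (Opens.infLERight (U x : Ck.Opens) (U y)).op (ρ y) =
        g cT * Ck.presheaf.map (Opens.infLELeft (U x : Ck.Opens) (U y)).op (ρ x) := by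
      have h := congrArg g hup
      rw [map_mul, hgdef, appLE_map_eq_map_app i inf_le_right l (Opens.infLERight (U x : Ck.Opens) (U y)) (r y),
        appLE_map_eq_map_app i inf_le_left l (Opens.infLELeft (U x : Ck.Opens) (U y)) (r x)] at h
      exact h
    -- hence the basis sections of `ψ` satisfy `c y| = g(cT) • c x|` (injectivity of `𝓘_{z} ↪ 𝒪` on sections)
    have hψrel : J.presheaf.map (Opens.infLERight (U x : Ck.Opens) (U y)).op (basisSection (ψ y) 0) =
        g cT • J.presheaf.map (Opens.infLELeft (U x : Ck.Opens) (U y)).op (basisSection (ψ x) 0) := by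
      apply kernel_ι_app_injective (structureModuleMap p)
      change toRing (idealModuleι p) _ _ = toRing (idealModuleι p) _ _
      rw [hψ x, hψ y, toRing_smul, ← map_toRing, ← map_toRing, hc x, hc y]
      exact hdown
    rw [transition_fin_one_eq_of_eq_smul (ψ x) (ψ y) _ _ (g cT) hψrel,
      transition_pullbackFrame i (φ x) (φ y) l]
    ext m n
    obtain rfl : m = 0 := Subsingleton.elim _ _
    obtain rfl : n = 0 := Subsingleton.elim _ _
    rw [Matrix.map_apply, Matrix.of_apply]
  exact ⟨isoOfFrames (fun x => (U x : Ck.Opens)) χ ψ hT hcov⟩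

end Summit.ResolutionOfSingularities.ResolutionOfSingularities.Cruxes.EquisingularLiftNat.F102

end
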